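import Summits.ABC.IUTFork.Conditional.AbcOfSHvolSplitHeight
import Summits.ABC.IUTFork.LDHSplitDepthPoints
import Summits.ABC.ABC.Theorems.IUTThetaPilotThetaPartIIULineCapstone
import HarnessLib

/-!
# Branch C, TARGET #1 (`hvol` / `hreg`): the CONE binder of `abc_of_S_v3` / `abc_of_S_v4` evaluated on a GENUINE
# family of quadratic `λ`-line points of unbounded split depth — the non-vacuity / unboundedness half of the
# Szpiro-type obstruction certificate (abc-iut cell, R2 S-chain team, seat abc-iut-s2-p3)

Record-only PROOF file (D-0012) of the abc-iut cell; TAKES NO SIDE on [IUTchIII] Cor. 3.12 or [IUTchIV] Thm. 1.10.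
S. Mochizuki, *IUT IV* [Mochizuki2012], Thm. 1.10 proof Step (v), kurims pp. 27–28 (the symmetrisation in `i† ∈ I`);
Cor. 2.2 (ii) proof pp. 45–46 ((P2), (P5), (P6)); Dupuy–Hilado [DupuyHilado2025] §3.3, §3.6, §4.7, §4.12.

CONTEXT. `Conditional.abc_of_S_v3` (p430884) closes `ABC` from the S_H-bundle and the CONE binder
`hvol : ∀ P ∈ UP, ∀ l prime ≥ 5, AdmitsCore → CondP2 → CondP5 → CondP6 → Cor22.HullVolumeAtDatum P l B_III(P,l)`;
`abc_of_S_v4` (p431657) replaces it by `hreg` (the same at non-slot-constant data; `hreg ⟹ hvol` by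
`ThetaPartII.hullVolume_of_hullRegime`, abc-iut-S3/S1/c312-8). abc-iut-s2-p5 (`AbcOfSHvolSplitHeight`, p435094) proved the
DATUM-FREE necessity: `HullVolumeAtDatum P l δ` + a datum force, for places `v, w` of `F_mod = ℚ(j(λ))` over one prime with
`v` (P5)-bad and `w` not, `Pr(v)·Pr(w)·(l(l+1)/12)·((−ord_v j(λ))/(2l))·log N(v)/n_v ≤ δ`. THIS FILE evaluates that
necessity on the GENUINE points of `LDHSplitDepthPoints` (abc-iut-s2-p3: quadratic field, one split multiplicative
prime of depth `≥ 2M`, `ℚ(j(λ)) = ℚ(λ)`):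

* `PointDict.finBelow_injective_of_adjoin_eq_top`, `weight_finBelow_eq_of_adjoin_eq_top` — when `ℚ(j(λ)) = F_tpd` the
  places of `F_tpd` ARE the places of `F_mod` (restriction is injective; weights agree, by weight descent);
* **`PointDict.splitPairPt_le_of_hullVolumeAtDatum`** — s2-p5's inequality read on the places `V, W` of the presenting
  field `F_tpd` itself when `ℚ(j(λ)) = F_tpd` (normalised local heights are extension-invariant,
  `ord_mul_logNorm_div_localDegree_algebraMap`);
* **`PointDict.splitDepth_le_of_hullVolumeAtDatum`** — at a point of `LDHSplitDepthPoints` shape (`Pr(V) = Pr(W) = 1/2`,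
  `n_V = 1`, `log N(V) = log p`, `ord_V j(λ) ≤ −2M`, `0 ≤ ord_W j(λ)`, `V ∤ 2l`): `HullVolumeAtDatum P l δ` + a datum
  force `(l+1)·M·log p/48 ≤ δ`;
* **`Conditional.splitDepthFamily_of_hvol_quadratic`** — from `hvol` VERBATIM, over ANY quadratic field with a split odd
  prime `p`: for every `M ≥ 1` a genuine point with the inequality `(l+1)·M·log p/48 ≤ B_III(P, l)` at every prime `l ≥ 5`,
  `l ≠ p` with (P2), (P6);
* **`Conditional.splitDepthFamily_of_hvol`** (+ `_explicit`: `d_mod = 2`, `log-diff = (log 3)/2` substituted) — from `hvol`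
  VERBATIM: for every `M ≥ 1` a GENUINE point `P_M = (ℚ(ζ₃), λ_M) ∈ UP`
  with `d_mod = 2`, admitting a core, (P5) at every prime `l ≠ 7`, such that for every prime `l ≥ 5`, `l ≠ 7`, with
  (P2) and (P6) at `(P_M, l)`: `(l+1)·M·log 7/48 ≤ B_III(P_M, l)` (datum by abc-iut-L5-t7's `ThetaPartII.stub_thetaData`);
* **`Conditional.splitDepthFamily_of_hreg`** — the same from v4's `hreg` VERBATIM (every datum at `P_M` is off the
  slot-constant regime, so `hreg` bites: via `ThetaPartII.hullVolume_of_hullRegime`).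

READING (for the planners; nothing asserted about print or about any author). `B_III(P_M, l) = (l+1)/4·{(1+24/l)·(log-diff(ℚ(ζ₃))
+ log-cond(λ_M)) + 2 log l + 52 + (20/3)·log(d*l)·π(d*l)}` with `d* = 2^13·3^3·5`; so the CONE binder asserts, on an explicit
infinite family of genuine points over ONE quadratic field, `log-cond^{∤2l}(λ_M) ≥ M·log 7/(12(1+24/l)) − C(l)` whenever the
classical conditions (P2), (P6) hold at `(P_M, l)` — an effective abc/Szpiro-type lower bound on the conductor of
`λ_M(1 − λ_M)`, LINEAR in the depth `M`: the binder is neither vacuous nor bounded at `d_mod = 2`; closing it proves that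
bound, refuting it exhibits an `M` violating it (an abc-violating configuration). Together with abc-iut-s2-p5 (necessity,
datum-free), abc-iut-s2-p1/s2-p2 (sufficiency / mixed share), abc-iut-s2-p4 (split locus ⟹ display) this is the cell's
«Szpiro-type obstruction» certificate for TARGET #1. HONEST SCOPE: consequences of the typed binder at genuine points;
(P2)/(P6) stay hypotheses (no size link to `M`); no side taken; typed ≠ proved. PROOF-ONLY file: no definitions.
[cite: Mochizuki2012, IUTchIV Thm. 1.10 Step (v) p. 27–28] [cite: Mochizuki2012, IUTchIV Cor. 2.2 (ii) proof p. 45–46]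
[cite: DupuyHilado2025, §3.3, §3.6, §4.7, §4.12] [cite: NeukirchANT1999, Ch. I §8] [claim: Mochizuki2012, status: disputed]
for every IUT quotation.
-/

noncomputable section

namespace Summit.ABC.IUTFork

open NumberField IsDedekindDomain Literature.IUT.LogVolume Literature.IUT.HodgeTheaters
open Literature.NumberTheory.DiophantineGeometry.GenEll
open scoped Classical

namespace PointDict

variable {P : NFPoint} {l : ℕ}

/-! ## `ℚ(j(λ)) = F_tpd`: the places of `F_tpd` are the places of `F_mod` -/

/-- When `ℚ(j(λ)) = F_tpd`, restriction of places `V(F_tpd) → V(ℚ(j(λ)))` is INJECTIVE (every algebraic integer of `F_tpd`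
comes from one of `ℚ(j(λ))`). [cite: NeukirchANT1999, Ch. I §8] -/
theorem finBelow_injective_of_adjoin_eq_top (htop : IntermediateField.adjoin ℚ ({Cor22.jInv P.x} : Set P.F) = ⊤) :
    Function.Injective (finBelow ↥(IntermediateField.adjoin ℚ ({Cor22.jInv P.x} : Set P.F)) P.F) := by
  set Fm : Type := ↥(IntermediateField.adjoin ℚ ({Cor22.jInv P.x} : Set P.F)) with hFm
  intro z x h
  apply HeightOneSpectrum.ext
  ext b
  have hbmem : (b : P.F) ∈ IntermediateField.adjoin ℚ ({Cor22.jInv P.x} : Set P.F) := by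
    rw [htop]; exact IntermediateField.mem_top
  set a : Fm := ⟨b, hbmem⟩ with ha_def
  have ha : algebraMap Fm P.F a = b := rfl
  have haint : IsIntegral ℤ a := by
    refine (isIntegral_algHom_iff (algebraMap Fm P.F).toIntAlgHom (algebraMap Fm P.F).injective).mp ?_
    change IsIntegral ℤ (algebraMap Fm P.F a)
    rw [ha]
    exact RingOfIntegers.isIntegral_coe b
  set a' : 𝓞 Fm := ⟨a, haint⟩ with ha'
  have hab : algebraMap (𝓞 Fm) (𝓞 P.F) a' = b := by
    apply RingOfIntegers.coe_injective
    exact ha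
  rw [← hab]
  change a' ∈ (finBelow Fm P.F z).asIdeal ↔ a' ∈ (finBelow Fm P.F x).asIdeal
  rw [h]

/-- When `ℚ(j(λ)) = F_tpd`, the weight of a place of `F_tpd` over `p` equals the weight of its restriction to `ℚ(j(λ))`
(weight descent over a one-point fibre). [cite: DupuyHilado2025, §3.6] [cite: NeukirchANT1999, Ch. I §8] -/
theorem weight_finBelow_eq_of_adjoin_eq_top (htop : IntermediateField.adjoin ℚ ({Cor22.jInv P.x} : Set P.F) = ⊤)
    {p : ℕ} [Fact p.Prime] (V : HeightOneSpectrum (𝓞 P.F)) (hV : V ∈ placesOver P.F p) :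
    weight ↥(IntermediateField.adjoin ℚ ({Cor22.jInv P.x} : Set P.F))
        (finBelow ↥(IntermediateField.adjoin ℚ ({Cor22.jInv P.x} : Set P.F)) P.F V) = weight P.F V := by
  set Fm : Type := ↥(IntermediateField.adjoin ℚ ({Cor22.jInv P.x} : Set P.F)) with hFm
  rw [← sum_filter_finBelow_weight Fm P.F (finBelow Fm P.F V) (finBelow_mem_placesOver Fm P.F hV)]
  have hset : (placesOver P.F p).filter (fun W => finBelow Fm P.F W = finBelow Fm P.F V) = {V} := by
    ext W
    simp only [Finset.mem_filter, Finset.mem_singleton]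
    constructor
    · rintro ⟨-, h⟩
      exact finBelow_injective_of_adjoin_eq_top htop h
    · rintro rfl
      exact ⟨hV, rfl⟩
  rw [hset, Finset.sum_singleton]

/-- **The split-pair inequality read on the presenting field when `ℚ(j(λ)) = ℚ(λ)`.** For `P = (F_tpd, λ)` with
`ℚ(j(λ)) = F_tpd`, places `V, W` of `F_tpd` over one rational prime `p` with `ord_V j(λ) < 0`, `V ∤ 2`, `V ∤ l` and
`0 ≤ ord_W j(λ)`: IF `Cor22.HullVolumeAtDatum P l δ` and a genuine Θ-volume datum exists at `(P, l)`, THEN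
`Pr(V)·Pr(W)·(l(l+1)/12)·((−ord_V j(λ))/(2l))·log N(V)/n_V ≤ δ` — abc-iut-s2-p5's `splitPair_le_of_hullVolumeAtDatum` (stated
on `F_mod = ℚ(j(λ))`) transported along the bijection of places (`finBelow` injective, weights and normalised local heights
invariant). Nothing asserted about any point. [cite: Mochizuki2012, IUTchIV Thm. 1.10 Step (v) p. 27–28]
[cite: DupuyHilado2025, §3.3, §3.6, §4.7, §4.12] [claim: Mochizuki2012, status: disputed] -/
theorem splitPairPt_le_of_hullVolumeAtDatum {δ : ℝ} (h : Cor22.HullVolumeAtDatum P l δ)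
    (T : Cor22.ThetaVolumeDatumAt P l) (htop : IntermediateField.adjoin ℚ ({Cor22.jInv P.x} : Set P.F) = ⊤)
    (p : ℕ) [Fact p.Prime] (V W : HeightOneSpectrum (𝓞 P.F)) (hV : V ∈ placesOver P.F p) (hW : W ∈ placesOver P.F p)
    (hVj : ord P.F V (Cor22.jInv P.x) < 0) (hV2 : ((2 : ℕ) : 𝓞 P.F) ∉ V.asIdeal) (hVl : ((l : ℕ) : 𝓞 P.F) ∉ V.asIdeal)
    (hWj : 0 ≤ ord P.F W (Cor22.jInv P.x)) :
    weight P.F V * weight P.F W * ((l : ℝ) * ((l : ℝ) + 1) / 12) *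
      (((-ord P.F V (Cor22.jInv P.x) : ℤ) : ℝ) / (2 * (l : ℝ)) * logNorm P.F V / (localDegree P.F V : ℝ)) ≤ δ := by
  set Fm : Type := ↥(IntermediateField.adjoin ℚ ({Cor22.jInv P.x} : Set P.F)) with hFm
  set v := finBelow Fm P.F V with hv_def
  set w := finBelow Fm P.F W with hw_def
  have hv : v ∈ placesOver Fm p := finBelow_mem_placesOver Fm P.F hV
  have hw : w ∈ placesOver Fm p := finBelow_mem_placesOver Fm P.F hW
  have hj : algebraMap Fm P.F (Cor22.jMod P) = Cor22.jInv P.x := rfl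
  have hvj : ord Fm v (Cor22.jMod P) < 0 := (Cor22.ord_algebraMap_neg_iff V (Cor22.jMod P)).mp (by rw [hj]; exact hVj)
  have hv2 : ((2 : ℕ) : 𝓞 Fm) ∉ v.asIdeal := fun h2 => hV2 ((Cor22.natCast_mem_asIdeal_finBelow_iff V 2).mp h2)
  have hvl : ((l : ℕ) : 𝓞 Fm) ∉ v.asIdeal := fun h2 => hVl ((Cor22.natCast_mem_asIdeal_finBelow_iff V l).mp h2)
  have hwj : 0 ≤ ord Fm w (Cor22.jMod P) ∨ ((2 : ℕ) : 𝓞 Fm) ∈ w.asIdeal ∨ ((l : ℕ) : 𝓞 Fm) ∈ w.asIdeal := by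
    refine Or.inl (not_lt.mp fun hlt => ?_)
    have := (Cor22.ord_algebraMap_neg_iff W (Cor22.jMod P)).mpr hlt
    rw [hj] at this
    exact absurd this (not_lt.mpr hWj)
  have key := splitPair_le_of_hullVolumeAtDatum h T p v w hv hw hvj hv2 hvl hwj
  rw [weight_finBelow_eq_of_adjoin_eq_top htop V hV, weight_finBelow_eq_of_adjoin_eq_top htop W hW] at key
  have hh : (ord P.F V (Cor22.jInv P.x) : ℝ) * logNorm P.F V / (localDegree P.F V : ℝ) =
      (ord Fm v (Cor22.jMod P) : ℝ) * logNorm Fm v / (localDegree Fm v : ℝ) :=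
    ord_mul_logNorm_div_localDegree_algebraMap V (Cor22.jMod P)
  have hterm : ((-ord P.F V (Cor22.jInv P.x) : ℤ) : ℝ) / (2 * (l : ℝ)) * logNorm P.F V / (localDegree P.F V : ℝ) =
      ((-ord Fm v (Cor22.jMod P) : ℤ) : ℝ) / (2 * (l : ℝ)) * logNorm Fm v / (localDegree Fm v : ℝ) := by
    push_cast
    calc -(ord P.F V (Cor22.jInv P.x) : ℝ) / (2 * (l : ℝ)) * logNorm P.F V / (localDegree P.F V : ℝ)
        = -(1 / (2 * (l : ℝ))) * ((ord P.F V (Cor22.jInv P.x) : ℝ) * logNorm P.F V / (localDegree P.F V : ℝ)) := by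
          ring
      _ = -(1 / (2 * (l : ℝ))) * ((ord Fm v (Cor22.jMod P) : ℝ) * logNorm Fm v / (localDegree Fm v : ℝ)) := by rw [hh]
      _ = -(ord Fm v (Cor22.jMod P) : ℝ) / (2 * (l : ℝ)) * logNorm Fm v / (localDegree Fm v : ℝ) := by ring
  rw [hterm]
  exact key

/-- **At a point of split depth `≥ 2M` the (U)-computable half forces `(l+1)·M·log p/48 ≤ δ`.** For `P = (F, λ)` with
`ℚ(j(λ)) = F`, places `V, W` of `F` over the odd prime `p` with `Pr(V) = Pr(W) = 1/2`, `n_V = 1`, `log N(V) = log p`,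
`ord_V j(λ) ≤ −2M` (`M ≥ 1`), `0 ≤ ord_W j(λ)`, `V ∤ 2`, `V ∤ l` — the shape of abc-iut-s2-p3's `SplitDepth.exists_point` —
`Cor22.HullVolumeAtDatum P l δ` and a genuine datum give `(1/4)·(l(l+1)/12)·((−ord_V j)/(2l))·log p ≤ δ`, hence
`(l+1)·M·log p/48 ≤ δ`. Nothing asserted about any point. [cite: Mochizuki2012, IUTchIV Thm. 1.10 Step (v) p. 27–28]
[cite: DupuyHilado2025, §3.3, §3.6, §4.7] [claim: Mochizuki2012, status: disputed] -/
theorem splitDepth_le_of_hullVolumeAtDatum {F : Type} [Field F] [NumberField F] {x : F} {δ : ℝ}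
    (h : Cor22.HullVolumeAtDatum (NFPoint.mk F x) l δ) (T : Cor22.ThetaVolumeDatumAt (NFPoint.mk F x) l) (hl : 0 < l)
    (htop : IntermediateField.adjoin ℚ ({Cor22.jInv x} : Set F) = ⊤) {p : ℕ} [Fact p.Prime]
    {V W : HeightOneSpectrum (𝓞 F)} (hV : V ∈ placesOver F p) (hW : W ∈ placesOver F p) {M : ℕ} (hM : 1 ≤ M)
    (hVj : ord F V (Cor22.jInv x) ≤ -(2 * M : ℤ)) (hWj : 0 ≤ ord F W (Cor22.jInv x))
    (hV2 : ((2 : ℕ) : 𝓞 F) ∉ V.asIdeal) (hVl : ((l : ℕ) : 𝓞 F) ∉ V.asIdeal)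
    (hwV : weight F V = 1 / 2) (hwW : weight F W = 1 / 2) (hnV : localDegree F V = 1) (hNV : logNorm F V = Real.log p) :
    ((l : ℝ) + 1) * M * Real.log p / 48 ≤ δ := by
  have key := splitPairPt_le_of_hullVolumeAtDatum (P := NFPoint.mk F x) h T htop p V W hV hW
    (by show ord F V (Cor22.jInv x) < 0; omega) hV2 hVl hWj
  change weight F V * weight F W * ((l : ℝ) * ((l : ℝ) + 1) / 12) *
      (((-ord F V (Cor22.jInv x) : ℤ) : ℝ) / (2 * (l : ℝ)) * logNorm F V / (localDegree F V : ℝ)) ≤ δ at key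
  rw [hwV, hwW, hnV, hNV] at key
  have hl0 : (0 : ℝ) < l := by exact_mod_cast hl
  have hlogp : 0 < Real.log p := Real.log_pos (by exact_mod_cast (Fact.out : p.Prime).one_lt)
  have hM' : (2 * M : ℝ) ≤ -(ord F V (Cor22.jInv x) : ℝ) := by
    have : (2 * M : ℤ) ≤ -ord F V (Cor22.jInv x) := by omega
    exact_mod_cast this
  have e1 : ((l : ℝ) + 1) * M * Real.log p / 48 =
      1 / 2 * (1 / 2) * ((l : ℝ) * ((l : ℝ) + 1) / 12) * ((2 * M : ℝ) / (2 * (l : ℝ)) * Real.log p / ((1 : ℕ) : ℝ)) := by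
    push_cast
    field_simp
    ring
  rw [e1]
  refine le_trans ?_ key
  have hc : 0 ≤ 1 / 2 * (1 / 2) * ((l : ℝ) * ((l : ℝ) + 1) / 12) := by positivity
  refine mul_le_mul_of_nonneg_left ?_ hc
  push_cast
  rw [div_one, div_one]
  exact mul_le_mul_of_nonneg_right (div_le_div_of_nonneg_right hM' (by positivity)) hlogp.le

end PointDict

namespace Conditional

open PointDict

/-- **THE CONE BINDER `hvol` ON GENUINE SPLIT-DEPTH POINTS OF ANY QUADRATIC FIELD.** Assume `hvol` VERBATIM. For every number
field `F` with `[F:ℚ] = 2`, every odd prime `p` under two distinct places `v₀ ≠ w` of `F` and every `M ≥ 1` there is `λ ∈ F` with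
`P := (F, λ) ∈ UP`, `d_mod(P) = 2`, `P` admitting a core and (P5) at every prime `l ≠ p` (abc-iut-s2-p3's `SplitDepth.exists_point`),
such that for every prime `l ≥ 5`, `l ≠ p`, at which (P2) and (P6) hold: `(l+1)·M·log p/48 ≤ B_III(P, l)`. Datum by
`ThetaPartII.stub_thetaData`. Nothing asserted about any point; (P2), (P6) are hypotheses; no side taken.
[cite: Mochizuki2012, IUTchIV Thm. 1.10 Step (v) p. 27–28] [cite: Mochizuki2012, IUTchIV Cor. 2.2 (ii) proof p. 45–46]
[claim: Mochizuki2012, status: disputed] -/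
theorem splitDepthFamily_of_hvol_quadratic
    (hvol : ∀ P₀ : NFPoint, P₀ ∈ UP → ∀ l : ℕ, l.Prime → 5 ≤ l →
      Cor22.AdmitsCore P₀ → Cor22.CondP2 P₀ l → Cor22.CondP5 P₀ l → Cor22.CondP6 P₀ l →
        Cor22.HullVolumeAtDatum P₀ l (((l : ℝ) + 1) / 4 *
          ((1 + 12 * (Cor22.dmod P₀ : ℝ) / l) * (P₀.logDiff + Cor22.logCondAvoid P₀ {2, l})
            + 2 * Real.log l + 52
            + 20 / 3 * Real.log (((2 ^ 12 * 3 ^ 3 * 5 * Cor22.dmod P₀ : ℕ) : ℝ) * (l : ℝ))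
              * (Nat.primeCounting (2 ^ 12 * 3 ^ 3 * 5 * Cor22.dmod P₀ * l) : ℝ))))
    {F : Type} [Field F] [NumberField F] (hF : Module.finrank ℚ F = 2) {p : ℕ} [Fact p.Prime] (hp2 : p ≠ 2)
    (v₀ w : placesOver F p) (hvw : w ≠ v₀) (M : ℕ) (hM : 1 ≤ M) :
    ∃ x : F, NFPoint.mk F x ∈ UP ∧ Cor22.dmod (NFPoint.mk F x) = 2 ∧ Cor22.AdmitsCore (NFPoint.mk F x) ∧
      (∀ l : ℕ, l.Prime → l ≠ p → Cor22.CondP5 (NFPoint.mk F x) l) ∧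
      ∀ l : ℕ, l.Prime → 5 ≤ l → l ≠ p → Cor22.CondP2 (NFPoint.mk F x) l → Cor22.CondP6 (NFPoint.mk F x) l →
        ((l : ℝ) + 1) * M * Real.log p / 48 ≤
          ((l : ℝ) + 1) / 4 *
            ((1 + 12 * (Cor22.dmod (NFPoint.mk F x) : ℝ) / l) *
                ((NFPoint.mk F x).logDiff + Cor22.logCondAvoid (NFPoint.mk F x) {2, l})
              + 2 * Real.log l + 52
              + 20 / 3 * Real.log (((2 ^ 12 * 3 ^ 3 * 5 * Cor22.dmod (NFPoint.mk F x) : ℕ) : ℝ) * (l : ℝ))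
                * (Nat.primeCounting (2 ^ 12 * 3 ^ 3 * 5 * Cor22.dmod (NFPoint.mk F x) * l) : ℝ)) := by
  obtain ⟨x, hUP, hd, htop, hcore, hP5, hjv, hjw, h2, hlp, hnv, -, hwv, hww, hlog⟩ :=
    SplitDepth.exists_point hF hp2 v₀ w hvw M hM
  refine ⟨x, hUP, hd, hcore, hP5, fun l hl h5 hlp' hP2 hP6 => ?_⟩
  obtain ⟨T⟩ := Summit.ABC.ABC.Theorems.ThetaPartII.stub_thetaData _ hUP l hl h5 hcore hP2 (hP5 l hl hlp') hP6
  have h := hvol _ hUP l hl h5 hcore hP2 (hP5 l hl hlp') hP6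
  exact splitDepth_le_of_hullVolumeAtDatum h T hl.pos htop v₀.2 w.2 hM hjv hjw h2 (hlp l hl hlp') hwv hww hnv hlog

/-- **THE CONE BINDER `hvol` OF `abc_of_S_v3` ON THE GENUINE SPLIT-DEPTH FAMILY.** Assume `hvol` VERBATIM (p430884 l. 375–381).
THEN for every `M ≥ 1` there is a GENUINE `λ`-line point `P_M = (ℚ(ζ₃), λ_M)` — `P_M ∈ UP`, `d_mod(P_M) = 2`, `P_M` admits a
core, (P5) holds at `(P_M, l)` for every prime `l ≠ 7` (abc-iut-s2-p3's `SplitDepth.exists_point_cyclotomicField_three`: one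
split multiplicative place over `7` of depth `≥ 2M`, its conjugate place not bad) — such that for every prime `l ≥ 5`,
`l ≠ 7`, at which the CLASSICAL conditions (P2), (P6) hold: `(l+1)·M·log 7/48 ≤ B_III(P_M, l)`, print's constant of [IUTchIV]
Thm. 1.10 Steps (ii)(iii)(v)(viii) (with `d_mod(P_M) = 2`). The datum is abc-iut-L5-t7's PROVED `ThetaPartII.stub_thetaData`.
READING: the left side is linear in the free depth `M`, the right side is `(l+1)/4·{(1+24/l)(log 3/2 + log-cond^{∤2l}(λ_M)) +
2 log l + 52 + (20/3) log(d*l) π(d*l)}`, `d* = 2^13·3^3·5` — so `hvol` asserts an effective Szpiro/abc-type LOWER BOUND on the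
conductor of `λ_M(1−λ_M)` over the fixed field `ℚ(ζ₃)`, for an explicit infinite family of genuine points: the binder is neither
vacuous nor bounded at `d_mod = 2`. Nothing asserted about any point, about print, or about any author; (P2), (P6) are
hypotheses; typed ≠ proved. [cite: Mochizuki2012, IUTchIV Thm. 1.10 Step (v) p. 27–28]
[cite: Mochizuki2012, IUTchIV Cor. 2.2 (ii) proof p. 45–46] [claim: Mochizuki2012, status: disputed] -/
theorem splitDepthFamily_of_hvol
    (hvol : ∀ P₀ : NFPoint, P₀ ∈ UP → ∀ l : ℕ, l.Prime → 5 ≤ l →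
      Cor22.AdmitsCore P₀ → Cor22.CondP2 P₀ l → Cor22.CondP5 P₀ l → Cor22.CondP6 P₀ l →
        Cor22.HullVolumeAtDatum P₀ l (((l : ℝ) + 1) / 4 *
          ((1 + 12 * (Cor22.dmod P₀ : ℝ) / l) * (P₀.logDiff + Cor22.logCondAvoid P₀ {2, l})
            + 2 * Real.log l + 52
            + 20 / 3 * Real.log (((2 ^ 12 * 3 ^ 3 * 5 * Cor22.dmod P₀ : ℕ) : ℝ) * (l : ℝ))
              * (Nat.primeCounting (2 ^ 12 * 3 ^ 3 * 5 * Cor22.dmod P₀ * l) : ℝ))))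
    (M : ℕ) (hM : 1 ≤ M) :
    ∃ x : CyclotomicField 3 ℚ,
      NFPoint.mk (CyclotomicField 3 ℚ) x ∈ UP ∧ Cor22.dmod (NFPoint.mk (CyclotomicField 3 ℚ) x) = 2 ∧
      Cor22.AdmitsCore (NFPoint.mk (CyclotomicField 3 ℚ) x) ∧
      (∀ l : ℕ, l.Prime → l ≠ 7 → Cor22.CondP5 (NFPoint.mk (CyclotomicField 3 ℚ) x) l) ∧
      ∀ l : ℕ, l.Prime → 5 ≤ l → l ≠ 7 →
        Cor22.CondP2 (NFPoint.mk (CyclotomicField 3 ℚ) x) l → Cor22.CondP6 (NFPoint.mk (CyclotomicField 3 ℚ) x) l →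
        ((l : ℝ) + 1) * M * Real.log 7 / 48 ≤
          ((l : ℝ) + 1) / 4 *
            ((1 + 12 * (Cor22.dmod (NFPoint.mk (CyclotomicField 3 ℚ) x) : ℝ) / l) *
                ((NFPoint.mk (CyclotomicField 3 ℚ) x).logDiff
                  + Cor22.logCondAvoid (NFPoint.mk (CyclotomicField 3 ℚ) x) {2, l})
              + 2 * Real.log l + 52
              + 20 / 3 * Real.log (((2 ^ 12 * 3 ^ 3 * 5 * Cor22.dmod (NFPoint.mk (CyclotomicField 3 ℚ) x) : ℕ) : ℝ) * (l : ℝ))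
                * (Nat.primeCounting (2 ^ 12 * 3 ^ 3 * 5 * Cor22.dmod (NFPoint.mk (CyclotomicField 3 ℚ) x) * l) : ℝ)) := by
  haveI h7 : Fact (Nat.Prime 7) := ⟨by norm_num⟩
  haveI hK : IsCyclotomicExtension {3} ℚ (CyclotomicField 3 ℚ) := CyclotomicField.isCyclotomicExtension 3 ℚ
  have hF : Module.finrank ℚ (CyclotomicField 3 ℚ) = 2 := by
    rw [IsCyclotomicExtension.Rat.finrank 3 (CyclotomicField 3 ℚ)]; decide
  obtain ⟨v₀, w, hvw⟩ := exists_two_placesOver_cyclotomicField_three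
  have h := splitDepthFamily_of_hvol_quadratic hvol hF (by norm_num) v₀ w hvw M hM
  have h7' : Real.log ((7 : ℕ) : ℝ) = Real.log 7 := by norm_num
  rw [h7'] at h
  exact h


/-- `log-diff` of a point presented over `ℚ(ζ₃)`: `(1/2)·log|disc ℚ(ζ₃)| = (log 3)/2` (Mathlib's cyclotomic discriminant
`disc ℚ(ζ_p) = (−1)^{(p−1)/2} p^{p−2}`). [cite: MochizukiGenEll2010, Def 1.5 (iii) p.8] [cite: NeukirchANT1999, Ch. I §10] -/
theorem logDiff_cyclotomicField_three (x : CyclotomicField 3 ℚ) :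
    (NFPoint.mk (CyclotomicField 3 ℚ) x).logDiff = Real.log 3 / 2 := by
  haveI hK : IsCyclotomicExtension {3} ℚ (CyclotomicField 3 ℚ) := CyclotomicField.isCyclotomicExtension 3 ℚ
  haveI : Fact (Nat.Prime 3) := ⟨by norm_num⟩
  rw [NFPoint.logDiff_eq_log_discr]
  have hd : NumberField.discr (CyclotomicField 3 ℚ) = (-1) ^ ((3 - 1) / 2) * (3 : ℕ) ^ (3 - 2) :=
    IsCyclotomicExtension.Rat.discr_prime 3 (CyclotomicField 3 ℚ)
  have hdeg : (NFPoint.mk (CyclotomicField 3 ℚ) x).degree = 2 := by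
    show Module.finrank ℚ (CyclotomicField 3 ℚ) = 2
    rw [IsCyclotomicExtension.Rat.finrank 3 (CyclotomicField 3 ℚ)]; decide
  rw [hdeg]
  show (((2 : ℕ) : ℝ))⁻¹ * Real.log ((NumberField.discr (CyclotomicField 3 ℚ)).natAbs : ℝ) = _
  rw [hd]
  norm_num
  ring

/-- **The family inequality with every constant of the field substituted** (`d_mod = 2`, `d* = 2^13·3^3·5`,
`log-diff = (log 3)/2`): from `hvol` VERBATIM, for every `M ≥ 1` a genuine `P_M = (ℚ(ζ₃), λ_M) ∈ UP` (core, (P5) at all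
`l ≠ 7`) with, for every prime `l ≥ 5`, `l ≠ 7`, (P2), (P6) at `(P_M, l)`:
`(l+1)·M·log 7/48 ≤ (l+1)/4·{(1 + 24/l)·((log 3)/2 + log-cond^{∤2l}(λ_M)) + 2 log l + 52 + (20/3)·log(2^13·3^3·5·l)·π(2^13·3^3·5·l)}`
— the only quantity of the point left on the right is the log-conductor `Cor22.logCondAvoid P_M {2,l}` of `λ_M`: an effective
Szpiro/abc-type lower bound on it, linear in the free depth `M`. Nothing asserted about any point; (P2), (P6) hypotheses; no
side taken. [cite: Mochizuki2012, IUTchIV Thm. 1.10 Step (v) p. 27–28] [cite: Mochizuki2012, IUTchIV Cor. 2.2 (ii) proof p. 45–46]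
[claim: Mochizuki2012, status: disputed] -/
theorem splitDepthFamily_of_hvol_explicit
    (hvol : ∀ P₀ : NFPoint, P₀ ∈ UP → ∀ l : ℕ, l.Prime → 5 ≤ l →
      Cor22.AdmitsCore P₀ → Cor22.CondP2 P₀ l → Cor22.CondP5 P₀ l → Cor22.CondP6 P₀ l →
        Cor22.HullVolumeAtDatum P₀ l (((l : ℝ) + 1) / 4 *
          ((1 + 12 * (Cor22.dmod P₀ : ℝ) / l) * (P₀.logDiff + Cor22.logCondAvoid P₀ {2, l})
            + 2 * Real.log l + 52
            + 20 / 3 * Real.log (((2 ^ 12 * 3 ^ 3 * 5 * Cor22.dmod P₀ : ℕ) : ℝ) * (l : ℝ))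
              * (Nat.primeCounting (2 ^ 12 * 3 ^ 3 * 5 * Cor22.dmod P₀ * l) : ℝ))))
    (M : ℕ) (hM : 1 ≤ M) :
    ∃ x : CyclotomicField 3 ℚ,
      NFPoint.mk (CyclotomicField 3 ℚ) x ∈ UP ∧ Cor22.AdmitsCore (NFPoint.mk (CyclotomicField 3 ℚ) x) ∧
      (∀ l : ℕ, l.Prime → l ≠ 7 → Cor22.CondP5 (NFPoint.mk (CyclotomicField 3 ℚ) x) l) ∧
      ∀ l : ℕ, l.Prime → 5 ≤ l → l ≠ 7 →
        Cor22.CondP2 (NFPoint.mk (CyclotomicField 3 ℚ) x) l → Cor22.CondP6 (NFPoint.mk (CyclotomicField 3 ℚ) x) l →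
        ((l : ℝ) + 1) * M * Real.log 7 / 48 ≤
          ((l : ℝ) + 1) / 4 *
            ((1 + 24 / (l : ℝ)) * (Real.log 3 / 2 + Cor22.logCondAvoid (NFPoint.mk (CyclotomicField 3 ℚ) x) {2, l})
              + 2 * Real.log l + 52
              + 20 / 3 * Real.log (((2 ^ 13 * 3 ^ 3 * 5 : ℕ) : ℝ) * (l : ℝ))
                * (Nat.primeCounting (2 ^ 13 * 3 ^ 3 * 5 * l) : ℝ)) := by
  obtain ⟨x, hUP, hd, hcore, hP5, h⟩ := splitDepthFamily_of_hvol hvol M hM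
  refine ⟨x, hUP, hcore, hP5, fun l hl h5 hl7 hP2 hP6 => ?_⟩
  have h' := h l hl h5 hl7 hP2 hP6
  rw [hd, logDiff_cyclotomicField_three] at h'
  have e1 : (2 ^ 12 * 3 ^ 3 * 5 * 2 : ℕ) = 2 ^ 13 * 3 ^ 3 * 5 := by norm_num
  rw [e1] at h'
  have e3 : (1 + 12 * ((2 : ℕ) : ℝ) / l) = 1 + 24 / (l : ℝ) := by push_cast; ring
  rw [e3] at h'
  exact h'

/-- **The same from v4's CONE binder `hreg`** (`Conditional.abc_of_S_v4`, p431657; = the body of the registered stub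
`stub_hullRegime` of crux `ThetaPartII`): `hreg ⟹ hvol` (`ThetaPartII.hullVolume_of_hullRegime`: slot-constant data and the
(R4) term are PROVED), so the genuine split-depth family reads `hreg` exactly as it reads `hvol` — every datum at `P_M` is off
the slot-constant regime anyway (a bad and a non-bad place of `F_mod` over `7`). Nothing asserted about any point; no side
taken. [cite: Mochizuki2012, IUTchIV Thm. 1.10 Step (v) p. 27–28] [claim: Mochizuki2012, status: disputed] -/
theorem splitDepthFamily_of_hreg
    (hreg : ∀ P : NFPoint, P ∈ UP → ∀ l : ℕ, l.Prime → 5 ≤ l →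
      Cor22.AdmitsCore P → Cor22.CondP2 P l → Cor22.CondP5 P l → Cor22.CondP6 P l →
      ∀ T : Cor22.ThetaVolumeDatumAt P l,
        (letI := T.instFieldF; letI := T.instNumberFieldF; letI := T.instAlgebraF; letI := T.instFieldK
         letI := T.instNumberFieldK; letI := T.instAlgebraK; letI := T.instFieldFbar; letI := T.instAlgebraFbar
         letI := T.instAlgebraKFbar; letI := T.instIsElliptic
         ¬ (∀ p ∈ T.I.supportPrimes, ∀ v w : placesOver (fieldOfModuli T.E) p,
            (Summit.ABC.IUTFork.DHData.ofInput T.I).logQloc p v = (Summit.ABC.IUTFork.DHData.ofInput T.I).logQloc p w)) →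
        T.HullEstimateOf
          (((l : ℝ) + 1) / 4 *
            ((1 + 12 * (Cor22.dmod P : ℝ) / l) * (P.logDiff + Cor22.logCondAvoid P {2, l})
              + 2 * Real.log l + 52
              + 20 / 3 * Real.log (((2 ^ 12 * 3 ^ 3 * 5 * Cor22.dmod P : ℕ) : ℝ) * (l : ℝ))
                * (Nat.primeCounting (2 ^ 12 * 3 ^ 3 * 5 * Cor22.dmod P * l) : ℝ))))
    (M : ℕ) (hM : 1 ≤ M) :
    ∃ x : CyclotomicField 3 ℚ,
      NFPoint.mk (CyclotomicField 3 ℚ) x ∈ UP ∧ Cor22.dmod (NFPoint.mk (CyclotomicField 3 ℚ) x) = 2 ∧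
      Cor22.AdmitsCore (NFPoint.mk (CyclotomicField 3 ℚ) x) ∧
      (∀ l : ℕ, l.Prime → l ≠ 7 → Cor22.CondP5 (NFPoint.mk (CyclotomicField 3 ℚ) x) l) ∧
      ∀ l : ℕ, l.Prime → 5 ≤ l → l ≠ 7 →
        Cor22.CondP2 (NFPoint.mk (CyclotomicField 3 ℚ) x) l → Cor22.CondP6 (NFPoint.mk (CyclotomicField 3 ℚ) x) l →
        ((l : ℝ) + 1) * M * Real.log 7 / 48 ≤
          ((l : ℝ) + 1) / 4 *
            ((1 + 12 * (Cor22.dmod (NFPoint.mk (CyclotomicField 3 ℚ) x) : ℝ) / l) *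
                ((NFPoint.mk (CyclotomicField 3 ℚ) x).logDiff
                  + Cor22.logCondAvoid (NFPoint.mk (CyclotomicField 3 ℚ) x) {2, l})
              + 2 * Real.log l + 52
              + 20 / 3 * Real.log (((2 ^ 12 * 3 ^ 3 * 5 * Cor22.dmod (NFPoint.mk (CyclotomicField 3 ℚ) x) : ℕ) : ℝ) * (l : ℝ))
                * (Nat.primeCounting (2 ^ 12 * 3 ^ 3 * 5 * Cor22.dmod (NFPoint.mk (CyclotomicField 3 ℚ) x) * l) : ℝ)) :=
  splitDepthFamily_of_hvol (Summit.ABC.ABC.Theorems.ThetaPartII.hullVolume_of_hullRegime hreg) M hM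

end Conditional

end Summit.ABC.IUTFork

end
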